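import Summits.ResolutionOfSingularities.ResolutionOfSingularities.Theorems.PurelyInseparableDim4PureLeafUnitOddPair
import HarnessLib
import HarnessLib.Audit.Tags

/-!
# Purely inseparable fourfolds — UNIFORM THEOREM, any partner: every unit leaf `x^a(1+x₀)` with `a₀ = 1`, ONE other exponent odd and the remaining two even is a plain-game A-WIN over `𝔽₂` ‖ K
# (cell res-dim4-pi; brick (δ) «unit leaves», UNIFORM family «a₀ = 1, one odd partner, even rest») [OURS · counted 0 · a theorem about OUR coordinate-centre frame v4, not about resolution]

Width seat `res-dim4-p-10` (g5).  `…PureLeafUnitOddPair` proves the family with the odd partner at `x₁`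
(`PureLeafNF.stateWins_unitLeaf_oneOdd`).  The frame is equivariant under renaming the variables (`…Equivariance`,
`PureLeafGlobalWin.stateWins_rename`), and the game reads `F` only (`WinCertF.stateWins_rebook`), so the partner may sit at
`x₂` or `x₃` as well: **`stateWins_unitLeaf_oneOdd_partner`** — for `k ≠ 0`, `a₀ = 1`, `a_k` odd and the other two exponents
even, `StateWins 2 ⟨x^a·(1+x₀), r, exc⟩` over `𝔽₂`, every booking.  Census instances (`a ∈ {1,2,3}⁴`): 1122 1212 1221 1223 1232
1322 (all already ‖ K by certificate, `…PureLeafUnitPlainOdd1`); the theorem covers every size.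

Riders: `𝔽₂`-rational replies; the PLAIN coordinate game of OUR frame v4, not MODE 1h, not CJS; nothing here proves F4-C(2,2),
`Terminates1h 2 2` or resolution of singularities in dimension ≥ 4 / characteristic `p`; counted 0; AI kernel work, weaker than
expert review. bears_on: LADDER-RESOLUTION:D157-DOOR2 (res-dim4-pi · brick (δ) · unit-leaf row, uniform theorem). Supports
stmt-ResolutionOfSingularities-16155 (helper).
-/

set_option linter.dupNamespace false

open MvPolynomial Finset

noncomputable section

namespace Summit.ResolutionOfSingularities.ResolutionOfSingularities.Theorems.PIDim4

namespace PureLeafNF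

open Literature.AlgebraicGeometry.Resolution

/-- Transport of the `x₁`-partner theorem along a renaming `e` of the variables fixing `x₀`. [folklore] -/
theorem stateWins_unitLeaf_oneOdd_of_perm (e : Equiv.Perm (Fin 4)) (he0 : e 0 = 0) (a : Fin 4 → ℕ)
    (h0 : a 0 = 1) (h1 : a (e 1) % 2 = 1) (h2 : a (e 2) % 2 = 0) (h3 : a (e 3) % 2 = 0)
    (r : Fin 4 →₀ ℕ) (exc : Finset (Fin 4)) :
    StateWins 2 (⟨monomial (Finsupp.equivFunOnFinite.symm a) 1 * (1 + X 0), r, exc⟩ : State (ZMod 2)) := by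
  have h' := stateWins_unitLeaf_oneOdd (fun i => a (e i)) (by simp [he0, h0]) h1 h2 h3 r exc
  have hren := WinCertF.stateWins_rebook (PureLeafGlobalWin.stateWins_rename e 2 h') r exc
  have key : rename e (monomial (Finsupp.equivFunOnFinite.symm fun i => a (e i)) 1 * (1 + X 0) : MvPolynomial (Fin 4) (ZMod 2)) =
      monomial (Finsupp.equivFunOnFinite.symm a) 1 * (1 + X 0) := by
    have hd : Finsupp.mapDomain (⇑e) (Finsupp.equivFunOnFinite.symm fun i => a (e i)) = Finsupp.equivFunOnFinite.symm a := by
      ext i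
      rw [Finsupp.mapDomain_equiv_apply]
      simp
    rw [map_mul, rename_monomial, hd, map_add, map_one (rename (⇑e)), rename_X, he0]
  have hF : (State.rename e (⟨monomial (Finsupp.equivFunOnFinite.symm fun i => a (e i)) 1 * (1 + X 0), r, exc⟩ : State (ZMod 2))).F =
      monomial (Finsupp.equivFunOnFinite.symm a) 1 * (1 + X 0) := key
  rw [hF] at hren
  exact hren

/-- **UNIFORM THEOREM (unit leaves, `a₀ = 1`, one odd partner ANYWHERE).** For `k ≠ 0` and every exponent vector `a` with
`a₀ = 1`, `a_k` odd and the two remaining exponents even, and every booking, the unit leaf `x^a·(1+x₀)` is an A-WIN of the plain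
game over `𝔽₂`. [OURS · counted 0 · ‖ K] [folklore] -/
theorem stateWins_unitLeaf_oneOdd_partner (k : Fin 4) (hk : k ≠ 0) (a : Fin 4 → ℕ) (h0 : a 0 = 1) (hk1 : a k % 2 = 1)
    (hev : ∀ i, i ≠ 0 → i ≠ k → a i % 2 = 0) (r : Fin 4 →₀ ℕ) (exc : Finset (Fin 4)) :
    StateWins 2 (⟨monomial (Finsupp.equivFunOnFinite.symm a) 1 * (1 + X 0), r, exc⟩ : State (ZMod 2)) := by
  fin_cases k
  · exact absurd rfl hk
  · exact stateWins_unitLeaf_oneOdd_of_perm (Equiv.refl _) rfl a h0 hk1 (hev 2 (by decide) (by decide))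
      (hev 3 (by decide) (by decide)) r exc
  · exact stateWins_unitLeaf_oneOdd_of_perm (Equiv.swap 1 2) (by decide) a h0 (by simpa using hk1)
      (by simpa using hev 1 (by decide) (by decide)) (by simpa [Equiv.swap_apply_of_ne_of_ne] using hev 3 (by decide) (by decide))
      r exc
  · exact stateWins_unitLeaf_oneOdd_of_perm (Equiv.swap 1 3) (by decide) a h0 (by simpa using hk1)
      (by simpa [Equiv.swap_apply_of_ne_of_ne] using hev 2 (by decide) (by decide)) (by simpa using hev 1 (by decide) (by decide))
      r exc

end PureLeafNF

end Summit.ResolutionOfSingularities.ResolutionOfSingularities.Theorems.PIDim4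

end
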